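import Summits.BirchSwinnertonDyer.BirchSwinnertonDyer.Theorems.AdditiveBranchIMCGordTwoRankZeroResidual
import Summits.BirchSwinnertonDyer.Rank1Residual.AdditivePotMult.MixedCongruentPartnerEPWGord
import Summits.BirchSwinnertonDyer.Rank1Residual.Additive.CongruentPartnerMainConjectureGordBSD
import Summits.BirchSwinnertonDyer.Rank1Residual.Additive.GordCycLeadingTermSemistableTwist
import HarnessLib

/-!
# Crux `GordTwoRankZeroOffCaseOne` (item 19357), IRREDUCIBLE rows with `ρ̄_{E,p}` onto: the per-pair
# DOORS that reach CONTENT rows — ONE unit coefficient of the branch series at the Tamagawa budget,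
# or a congruent partner of Mordell–Weil rank `≥ λ` ("Route G" of team n1011, composed into the
# route's currency) — and why the unit-`L`-value partner of gen 2 reaches no content row

Cell `bsd-addord`, seat `bsd-addord-k1-c2` (D-0074 row B1), gen 3. HONEST FRAMING: nothing here proves
the Birch–Swinnerton-Dyer conjecture or the crux; THEOREMS ONLY (no definition, no named fact, no
`sorry`); every published input is an explicit named-fact binder; every per-pair input (unit
coefficient = ENGINE value under the two-engine rule; `E[p] ≅ E₁[p]` = Kraus–Oesterlé / Sturm
certificate; the partner's Mordell–Weil rank = generators; the finite set `Σ₀` of bad places) is a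
displayed binder discharged OUTSIDE the kernel; nothing is booked by this file.

## Why this file (the correction of record)

Gen 2 of this seat built the Emerton–Pollack–Weston branch road with the base case "a congruent good
ordinary `V₁` whose `p*`-twist `E₁` has `ord_p(L(E₁,1)/Ω_{E₁}) = 0`" (`…Congruence*.lean`). On the rows
where the crux has content (`p ∣ #Ш(E)_an`, no `p`-Tamagawa budget) NO SUCH PARTNER EXISTS: by
Emerton–Pollack–Weston Thm. 3.3.3 / its analytic twin (team n1011's reading R-B, cell `b2b-bsdres`,
`cells/n1011/ROUTE-2.md` §II.9.2, census-tested 2026-08-21) `λ(E) − B(E,p)` is CONSTANT on a same-branch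
congruence class, `B(E,p) = Σ_{ℓ ≠ p, p ∣ c_ℓ(E)} p^{n_ℓ}` the `p`-Tamagawa budget; a content row with
`B(E,p) = 0` has `λ(E) ≥ 2` (`μ = 0`, `f(0)` a non-unit, parity), so every congruent `E₁` has
`λ(E₁) = λ(E) + B(E₁,p) ≥ 2` and its `L`-value is never a `p`-unit (n1011 census: "LOWER-type → 0 unit
candidates at p ≥ 5"). What DOES reach content rows is n1011's variant (c): a congruent partner `E₁`
with `rank E₁(ℚ) ≥ λ(E₁)` — Kato's divisibility + Mordell–Weil squeeze the main conjecture at `E₁`, EPW's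
algebraic transfer (`muLambdaAlg_transfer_of_torsionIso_potOrd`, Thms. 3.3.2 / 3.3.3) carries the
λ-budget to `E`, and ONE unit coefficient of `E`'s own branch series at index `b = r₁ + e` closes the
squeeze at `E` (n1011 census, truncated lists: a deep-congruent CLEAN RANK-2 partner for 42 of the 92
pure-Ш (G-ord, `e = 2`) rows at `p = 5` and 5 of those at `p = 7`, all with `#Ш_an = p²` — e.g.
2900d1 ~ 2900c1, 10850m1 ~ 10850k1 at 5; 71148bh1 ~ 71148bg1 at 7). The Tamagawa rows (`B(E,p) ≥ 1`;
31 at `p = 5`, 6 at `p = 7`) are reached partner-free by the budget `BudgetLeLambdaAt p W B(E,p)`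
(EPW Cor. 3.2.5, typed per curve).

## What (all on cell (G-ord, `e = 2`) ∩ {`ρ̄_{E,p}` onto} ∩ `r_an = 0`; every odd `p` unless said)

* §1 LOWER half `MissingLowerBoundAt W p` — the crux's conclusion at the pair — from Kato half (`hK`),
  Delbourgo 1998 Prop. 4 intrinsic (`hDelG`, a `ReadingFacts` conjunct), Pal (`hPal`), GZK / modularity
  (`hGZK hmod hmodD`, `PrintedFacts` conjuncts) and the per-pair data, in three doors:
  `…_of_katoHalf_of_coeffCert_of_budget` (unit coefficient at `b` + budget `b ≤ λ`),
  `…_of_epw_of_rankPartner` (+ `hEPW`; partner of the SAME cell with `r₁ ≤ rank E₁(ℚ)`,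
  `b ≤ r₁ + Σ_{w∈Σ₀}(δ(E₁,w) − δ(E,w))`), `…_of_epw_of_multPartner` (+ `hT40 hT41`; partner in cell
  (M)). NO `¬CM`, NO non-anomalous, NO `p ≥ 5` binder (gen 0's transport is image- and anomaly-free) —
  sharper than n1011's `…_of_nonAnomalous` consumers, which carry Delbourgo 2002 (A)+(B), `¬CM`, `hna`.
* §2 `BSD(E,p)` at `p ≥ 5` on the same rows, `hna`-free and Delbourgo-2002-free: §1 + the Kato upper
  half on the semistable-twist locus (`Addv.missingUpperBoundAt_rankZero_of_semistableTwist_of_surj`,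
  Delbourgo 1998 Prop. 4 weak form `hDel98`) — the BOOKING door for the B2 off-Case-1 content cells.
* §3 the same doors with the route's `PrintedFacts` / `ReadingFacts` conjunctions, and the crux BY NAME
  from row data: `gordTwoRankZeroOffCaseOne_of_facts_of_routeG` — PrintedFacts → ReadingFacts → CM BSD
  (`hCM`) → Pal → Kato half → [every non-CM content off-Case-1 rank-0 row of the cell is EITHER onto
  with a certified index `b` (coefficient + budget) OR satisfies the `T = 0` input directly] → crux.
  The bracket is NOT a theorem (non-surjective irreducible rows and the Eisenstein-degenerate reducible
  rows have no door here; pure-Ш rows without a rank-`≥ λ` partner in range have none anywhere): the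
  crux stays OPEN; the theorem records exactly what a per-pair certificate buys.

References: Emerton–Pollack–Weston, Invent. Math. 163 (2006) Thm. 3.1.1, Cor. 3.2.5, Thms. 3.3.2/3.3.3,
Lemma 5.1.5 [EmertonPollackWeston2006]; Kato, Astérisque 295 (2004) Thm. 17.4 (3) [Kato2004Asterisque];
Greenberg–Vatsal, Invent. Math. 142 (2000) §2 [GreenbergVatsal2000]; Delbourgo, Compositio Math. 113
(1998) Prop. 4 [Delbourgo1998]; Pal, [Pal2012] Thm. 3.2; Silverman, GTM 151 (1994) V.3.1/V.5.3/V.5.4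
[Silverman1994]; Miller, LMS J. Comput. Math. 14 (2011) Def. 1.1 [Miller2011LMS]; Burungale–Flach,
Camb. J. Math. 12 (2024) Thm. 1.1 [BurungaleFlach2024].
-/

noncomputable section

open scoped Classical MatrixGroups ModularForm NumberField

open CongruenceSubgroup WeierstrassCurve NumberField IsDedekindDomain Field
  Literature.NumberTheory.EllipticCurves
  Literature.NumberTheory.EllipticCurves.ModularForms
  Literature.NumberTheory.EllipticCurves.Rank1Residual
  Literature.NumberTheory.EllipticCurves.Rank1Residual.Typed
  Literature.NumberTheory.EllipticCurves.GreenbergSelmer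
  Literature.NumberTheory.EllipticCurves.Wuthrich2014
  Literature.NumberTheory.EllipticCurves.GreenbergVatsal2000
  Literature.NumberTheory.EllipticCurves.EmertonPollackWeston2006
  Literature.NumberTheory.GaloisRepresentations
  Summit.BirchSwinnertonDyer.Rank1Residual.X1.MuLambda
  Summit.BirchSwinnertonDyer.Rank1Residual.Iwasawa

open Summit.BirchSwinnertonDyer.Rank1Residual.X1.CongruenceTransfer (TorsionIso CongruentLambdaShift)

set_option autoImplicit false
set_option linter.dupNamespace false

namespace Summit.BirchSwinnertonDyer.BirchSwinnertonDyer.Theorems.AdditiveBranchIMCGordTwoRankZeroIrreducible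

open Summit.BirchSwinnertonDyer.Rank1Residual
open Summit.BirchSwinnertonDyer.Rank1Residual.Additive
open Summit.BirchSwinnertonDyer.Rank1Residual.AdditivePotMult
open Summit.BirchSwinnertonDyer.BirchSwinnertonDyer.Theses.AdditiveBranchIMC
open Summit.BirchSwinnertonDyer.BirchSwinnertonDyer.Theorems.AdditiveBranchIMCGordTwoRankZeroTransport
open Summit.BirchSwinnertonDyer.BirchSwinnertonDyer.Theorems.AdditiveBranchIMCGordTwoRankZeroResidual
open Summit.BirchSwinnertonDyer.BirchSwinnertonDyer.Theorems.AdditiveBranchIMCGordTwoRankOne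

variable {W : WeierstrassCurve ℚ} [W.IsElliptic] [W.IsGloballyMinimal] {p : ℕ} [hp : Fact p.Prime]

/-- On cell (G-ord, `e = 2`) a pair with `ρ̄_{E,p}` onto is an X4♯(G-ord) pair (onto ⟹ irreducible,
Serre). [cite: Serre1972, §4 (onto ⟹ irreducible)] -/
theorem classX4Gord_of_cellGordTwo_of_surj (hc : N10.CellGordTwo W p) (hsurj : Surj W p) :
    ClassX4Gord W p :=
  ⟨⟨hc.1, hc.2.1, hasIrreducibleModPGaloisRep_of_hasSurjectiveModNGaloisRep W p hsurj⟩, hc.2.2.1⟩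

/-! ## §1 The LOWER half at the pair from a certificate — three doors, every odd `p`, no `¬CM` / `hna` -/

/-- **Door 1 (budget): cell (G-ord, `e = 2`) ∩ {`ρ̄_{E,p}` onto} ∩ `r_an = 0`, every odd `p`.** Kato's
half-eigenspace divisibility (`hK`), ONE unit coefficient of the Néron-normalised branch series at index
`b` (`BranchUnitCoeffAt W p b`) and the budget `b ≤ λ(X(E/ℚ_∞))` (`BudgetLeLambdaAt p W b`, EPW Cor. 3.2.5
with `b = B(E,p)`) give the branch main conjecture at `E` (team n1011's Route G), hence the `T = 0` lower
input `CycLowerLeadingTermAt W p` (`ClassX4Gord.cycLowerLeadingTermAt_of_katoHalf_of_coeffCert_of_budget`),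
hence `ord_p #Ш(E)_an ≤ ord_p #Ш(E)` by gen 0's image-free transport (Delbourgo 1998 Prop. 4 intrinsic
`hDelG`, GZK, modularity). No `¬CM`, non-anomalous or `p ≥ 5` hypothesis.
[cite: Kato2004Asterisque, Thm. 17.4 (3) (p. 273)] [cite: EmertonPollackWeston2006, Cor. 3.2.5 and Thm. 3.1.1 (budget shape)]
[cite: Delbourgo1998, Prop. 4 (p. 144)] [cite: Pal2012, Thm. 3.2] [cite: Miller2011LMS, Def. 1.1] -/
theorem missingLowerBoundAt_rankZero_surj_of_katoHalf_of_coeffCert_of_budget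
    (hK : Wuthrich2014.kato_halfEigenCharIdeal_dvd_cyclotomicPrime_of_surjective)
    (hDelG : Delbourgo1998.prop4_rankZero_constantCoeff_eq_unit_mul_of_potGoodOrd)
    (hPal : Pal2012.thm32_sqrt_mul_realPeriodRat_twist_eq_of_prime_one_mod_four)
    (hGZK : rank_eq_analyticRank_of_analyticRank_le_one) (hmod : hasEntireLFunction_rat)
    (hmodD : nonempty_modularParametrizationData)
    (hc : N10.CellGordTwo W p) (hsurj : Surj W p) (hr : W.analyticRank = 0)
    {b : ℕ} (hcert : BranchUnitCoeffAt W p b) (hbud : BudgetLeLambdaAt p W b) :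
    MissingLowerBoundAt W p :=
  missingLowerBoundAt_cellGordTwo_rankZero_of_cycLowerLeadingTerm hDelG hGZK hmod hc hr
    ((classX4Gord_of_cellGordTwo_of_surj hc hsurj).cycLowerLeadingTermAt_of_katoHalf_of_coeffCert_of_budget
      hK hPal hmod hmodD hc.2.2.2 hsurj hcert hbud)

/-- **Door 2 (rank partner in the same cell): cell (G-ord, `e = 2`) ∩ {`ρ̄_{E,p}` onto} ∩ `r_an = 0`,
every odd `p`.** A congruent partner `E₁` (globally minimal `W₁`) of the SAME cell — X4♯(G-ord),
`e_{E₁}(p) = 2`, `ρ̄_{E₁,p}` onto — with `E[p] ≅ E₁[p]` (`TorsionIso`), a finite set `Σ₀ ∌ p` of places off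
which both curves are good, `r₁ ≤ rank E₁(ℚ)`, and ONE unit coefficient of `E`'s branch series at an
index `b ≤ r₁ + Σ_{w ∈ Σ₀} (δ(E₁,w) − δ(E,w))`: then the budget `b ≤ λ(X(E/ℚ_∞))` holds by EPW's algebraic
transfer (`hEPW`, Thms. 3.3.2/3.3.3: `λ(E) = λ(E₁) + e`, `λ(E₁) ≥ rank E₁(ℚ)` by Kato + Mordell–Weil at the
partner; n1011's `ClassX4Gord.budgetLeLambdaAt_of_epw_of_gordPartner_of_congr`), and Door 1 applies.
This is the road that reaches the pure-Ш rows (`#Ш_an = p²`, rank-2 visibility partners).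
[cite: EmertonPollackWeston2006, Thm. 3.3.2, Thm. 3.3.3 (2) (arXiv:math/0404484 p. 19), Lemma 5.1.5 (p. 30)]
[cite: Kato2004Asterisque, Thm. 17.4 (3) (p. 273)] [cite: GreenbergVatsal2000, Thm. (1.4) and §2]
[cite: Delbourgo1998, Prop. 4 (p. 144)] [cite: Miller2011LMS, Def. 1.1] -/
theorem missingLowerBoundAt_rankZero_surj_of_epw_of_rankPartner
    (hK : Wuthrich2014.kato_halfEigenCharIdeal_dvd_cyclotomicPrime_of_surjective)
    (hEPW : muLambdaAlg_transfer_of_torsionIso_potOrd)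
    (hDelG : Delbourgo1998.prop4_rankZero_constantCoeff_eq_unit_mul_of_potGoodOrd)
    (hPal : Pal2012.thm32_sqrt_mul_realPeriodRat_twist_eq_of_prime_one_mod_four)
    (hGZK : rank_eq_analyticRank_of_analyticRank_le_one) (hmod : hasEntireLFunction_rat)
    (hmodD : nonempty_modularParametrizationData)
    (hc : N10.CellGordTwo W p) (hsurj : Surj W p) (hr : W.analyticRank = 0)
    {W₁ : WeierstrassCurve ℚ} [W₁.IsElliptic] [W₁.IsGloballyMinimal]
    (hX₁ : ClassX4Gord W₁ p) (he₁ : semistabilityIndex W₁ p = 2) (hsurj₁ : Surj W₁ p) {r₁ : ℕ}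
    (hr₁ : r₁ ≤ W₁.mordellWeilRank) (hT : TorsionIso W W₁ p)
    (S₀ : Finset (HeightOneSpectrum (𝓞 ℚ))) (hS₀ : ∀ w ∈ S₀, ((p : ℕ) : 𝓞 ℚ) ∉ w.asIdeal)
    (hS : ∀ w : HeightOneSpectrum (𝓞 ℚ), w ∉ S₀ → ((p : ℕ) : 𝓞 ℚ) ∉ w.asIdeal →
      W.HasGoodReductionAt w)
    (hS₁ : ∀ w : HeightOneSpectrum (𝓞 ℚ), w ∉ S₀ → ((p : ℕ) : 𝓞 ℚ) ∉ w.asIdeal →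
      W₁.HasGoodReductionAt w)
    {b : ℕ} (hb : (b : ℤ) ≤ r₁ + ∑ w ∈ S₀, ((delta W₁ p w : ℤ) - (delta W p w : ℤ)))
    (hcert : BranchUnitCoeffAt W p b) : MissingLowerBoundAt W p :=
  missingLowerBoundAt_rankZero_surj_of_katoHalf_of_coeffCert_of_budget hK hDelG hPal hGZK hmod hmodD hc
    hsurj hr hcert
    ((classX4Gord_of_cellGordTwo_of_surj hc hsurj).budgetLeLambdaAt_of_epw_of_gordPartner_of_congr hEPW
      hK hmodD hc.2.2.2 hX₁ he₁ hsurj₁ hr₁ hT S₀ hS₀ hS hS₁ hb)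

/-- **Door 3 (rank partner in cell (M)): cell (G-ord, `e = 2`) ∩ {`ρ̄_{E,p}` onto} ∩ `r_an = 0`, every
odd `p`.** As Door 2 with the partner `E₁` in X4(M) (potentially multiplicative at `p`, `ρ̄_{E₁,p}` onto):
both members of a congruence class on the branch are legitimate partners (EPW's Hida family contains the
`p`-new members; the (M) ramified ordinary line is Tate's uniformisation, `hT40`/`hT41` = Silverman 1994
V.3.1 / V.5.3–5.4); n1011's `ClassX4Gord.budgetLeLambdaAt_of_epw_of_multPartner_of_congr`, then Door 1.
[cite: EmertonPollackWeston2006, Thm. 3.3.2, Thm. 3.3.3 (2) (arXiv:math/0404484 p. 19)]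
[cite: Silverman1994, Thm. V.3.1, Thm. V.5.3, Cor. V.5.4] [cite: Kato2004Asterisque, Thm. 17.4 (3) (p. 273)]
[cite: Delbourgo1998, Prop. 4 (p. 144)] [cite: Miller2011LMS, Def. 1.1] -/
theorem missingLowerBoundAt_rankZero_surj_of_epw_of_multPartner
    (hK : Wuthrich2014.kato_halfEigenCharIdeal_dvd_cyclotomicPrime_of_surjective)
    (hEPW : muLambdaAlg_transfer_of_torsionIso_potOrd)
    (hT40 : Silverman1994_thmV53_tateUniformisation.{0})
    (hT41 : Silverman1994_thmV53_corV54_tateUniformisation.{0})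
    (hDelG : Delbourgo1998.prop4_rankZero_constantCoeff_eq_unit_mul_of_potGoodOrd)
    (hPal : Pal2012.thm32_sqrt_mul_realPeriodRat_twist_eq_of_prime_one_mod_four)
    (hGZK : rank_eq_analyticRank_of_analyticRank_le_one) (hmod : hasEntireLFunction_rat)
    (hmodD : nonempty_modularParametrizationData)
    (hc : N10.CellGordTwo W p) (hsurj : Surj W p) (hr : W.analyticRank = 0)
    {W₁ : WeierstrassCurve ℚ} [W₁.IsElliptic] [W₁.IsGloballyMinimal]
    (hX₁ : ClassX4M W₁ p) (hsurj₁ : Surj W₁ p) {r₁ : ℕ} (hr₁ : r₁ ≤ W₁.mordellWeilRank)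
    (hcong : ∃ e : geomTorsion W (p : ℤ) ≃+ geomTorsion W₁ (p : ℤ),
      ∀ (σ : absoluteGaloisGroup ℚ) (P : geomTorsion W (p : ℤ)), e (σ • P) = σ • e P)
    (S₀ : Finset (HeightOneSpectrum (𝓞 ℚ))) (hS₀ : ∀ w ∈ S₀, ((p : ℕ) : 𝓞 ℚ) ∉ w.asIdeal)
    (hS : ∀ w : HeightOneSpectrum (𝓞 ℚ), w ∉ S₀ → ((p : ℕ) : 𝓞 ℚ) ∉ w.asIdeal →
      W.HasGoodReductionAt w)
    (hS₁ : ∀ w : HeightOneSpectrum (𝓞 ℚ), w ∉ S₀ → ((p : ℕ) : 𝓞 ℚ) ∉ w.asIdeal →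
      W₁.HasGoodReductionAt w)
    {b : ℕ} (hb : (b : ℤ) ≤ r₁ + ∑ w ∈ S₀, ((delta W₁ p w : ℤ) - (delta W p w : ℤ)))
    (hcert : BranchUnitCoeffAt W p b) : MissingLowerBoundAt W p :=
  missingLowerBoundAt_rankZero_surj_of_katoHalf_of_coeffCert_of_budget hK hDelG hPal hGZK hmod hmodD hc
    hsurj hr hcert
    ((classX4Gord_of_cellGordTwo_of_surj hc hsurj).budgetLeLambdaAt_of_epw_of_multPartner_of_congr hEPW
      hK hmodD hT40 hT41 hc.2.2.2 hX₁ hsurj₁ hr₁ hcong S₀ hS₀ hS hS₁ hb)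

/-! ## §2 `BSD(E,p)` at `p ≥ 5` on the same rows, `hna`-free: the booking door -/

/-- **`BSD(E,p)` from the budget certificate, `p ≥ 5`: cell (G-ord, `e = 2`) ∩ {`ρ̄_{E,p}` onto} ∩
`r_an = 0`.** §1 Door 1 (lower half) + the Kato UPPER half on the semistable-twist locus
(`Addv.missingUpperBoundAt_rankZero_of_semistableTwist_of_surj`: Kato half, Delbourgo 1998 Prop. 4 weak
form `hDel98`, Pal, GZK, modularity; the good-ordinary twist model exists on the cell) + Miller's
bookkeeping (`missingPPartAt_of_lower_of_upper`, `bsdp_of_missingPPartAt`). NO `¬CM`, NO non-anomalous,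
NO Delbourgo 2002 binder. Per pair modulo `hK` and the displayed certificate; books nothing by itself.
[cite: Kato2004Asterisque, Thm. 17.4 (3) (p. 273)] [cite: Delbourgo1998, Prop. 4 (p. 144)]
[cite: Pal2012, Thm. 3.2] [cite: EmertonPollackWeston2006, Cor. 3.2.5 (budget shape)] [cite: Miller2011LMS, Def. 1.1] -/
theorem bsdp_rankZero_surj_of_katoHalf_of_coeffCert_of_budget
    (hK : Wuthrich2014.kato_halfEigenCharIdeal_dvd_cyclotomicPrime_of_surjective)
    (hDel98 : Delbourgo1998.prop4_rankZero_pow_dvd_constantCoeff)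
    (hDelG : Delbourgo1998.prop4_rankZero_constantCoeff_eq_unit_mul_of_potGoodOrd)
    (hPal : Pal2012.thm32_sqrt_mul_realPeriodRat_twist_eq_of_prime_one_mod_four)
    (hGZK : rank_eq_analyticRank_of_analyticRank_le_one) (hmod : hasEntireLFunction_rat)
    (hmodD : nonempty_modularParametrizationData)
    (hc : N10.CellGordTwo W p) (hsurj : Surj W p) (hp5 : 5 ≤ p) (hr : W.analyticRank = 0)
    {b : ℕ} (hcert : BranchUnitCoeffAt W p b) (hbud : BudgetLeLambdaAt p W b) : BSDp W p := by
  obtain ⟨V, _, _, C, hV, hC⟩ := ClassX4Gord.exists_goodOrd_pStar_twist_model W p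
    (classX4Gord_of_cellGordTwo_of_surj hc hsurj) hc.2.2.2
  exact bsdp_of_missingPPartAt W p hGZK (by omega)
    (missingPPartAt_of_lower_of_upper W p
      (missingLowerBoundAt_rankZero_surj_of_katoHalf_of_coeffCert_of_budget hK hDelG hPal hGZK hmod hmodD
        hc hsurj hr hcert hbud)
      (Addv.missingUpperBoundAt_rankZero_of_semistableTwist_of_surj hK hDel98 hPal hGZK hmod hmodD hp5
        hc.2.1 V C hC (Or.inl hV) hsurj hr))

/-- **`BSD(E,p)` from a rank partner in the same cell, `p ≥ 5`** (§1 Door 2 + the Kato upper half):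
the door for the pure-Ш rows `#Ш(E)_an = p²` with a rank-2 congruent partner. Per pair modulo `hK`,
`hEPW` and the displayed certificates; books nothing by itself.
[cite: EmertonPollackWeston2006, Thm. 3.3.2, Thm. 3.3.3 (2) (arXiv:math/0404484 p. 19)]
[cite: Kato2004Asterisque, Thm. 17.4 (3) (p. 273)] [cite: Delbourgo1998, Prop. 4 (p. 144)]
[cite: GreenbergVatsal2000, Thm. (1.4)] [cite: Miller2011LMS, Def. 1.1] -/
theorem bsdp_rankZero_surj_of_epw_of_rankPartner
    (hK : Wuthrich2014.kato_halfEigenCharIdeal_dvd_cyclotomicPrime_of_surjective)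
    (hEPW : muLambdaAlg_transfer_of_torsionIso_potOrd)
    (hDel98 : Delbourgo1998.prop4_rankZero_pow_dvd_constantCoeff)
    (hDelG : Delbourgo1998.prop4_rankZero_constantCoeff_eq_unit_mul_of_potGoodOrd)
    (hPal : Pal2012.thm32_sqrt_mul_realPeriodRat_twist_eq_of_prime_one_mod_four)
    (hGZK : rank_eq_analyticRank_of_analyticRank_le_one) (hmod : hasEntireLFunction_rat)
    (hmodD : nonempty_modularParametrizationData)
    (hc : N10.CellGordTwo W p) (hsurj : Surj W p) (hp5 : 5 ≤ p) (hr : W.analyticRank = 0)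
    {W₁ : WeierstrassCurve ℚ} [W₁.IsElliptic] [W₁.IsGloballyMinimal]
    (hX₁ : ClassX4Gord W₁ p) (he₁ : semistabilityIndex W₁ p = 2) (hsurj₁ : Surj W₁ p) {r₁ : ℕ}
    (hr₁ : r₁ ≤ W₁.mordellWeilRank) (hT : TorsionIso W W₁ p)
    (S₀ : Finset (HeightOneSpectrum (𝓞 ℚ))) (hS₀ : ∀ w ∈ S₀, ((p : ℕ) : 𝓞 ℚ) ∉ w.asIdeal)
    (hS : ∀ w : HeightOneSpectrum (𝓞 ℚ), w ∉ S₀ → ((p : ℕ) : 𝓞 ℚ) ∉ w.asIdeal →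
      W.HasGoodReductionAt w)
    (hS₁ : ∀ w : HeightOneSpectrum (𝓞 ℚ), w ∉ S₀ → ((p : ℕ) : 𝓞 ℚ) ∉ w.asIdeal →
      W₁.HasGoodReductionAt w)
    {b : ℕ} (hb : (b : ℤ) ≤ r₁ + ∑ w ∈ S₀, ((delta W₁ p w : ℤ) - (delta W p w : ℤ)))
    (hcert : BranchUnitCoeffAt W p b) : BSDp W p :=
  bsdp_rankZero_surj_of_katoHalf_of_coeffCert_of_budget hK hDel98 hDelG hPal hGZK hmod hmodD hc hsurj hp5 hr
    hcert
    ((classX4Gord_of_cellGordTwo_of_surj hc hsurj).budgetLeLambdaAt_of_epw_of_gordPartner_of_congr hEPW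
      hK hmodD hc.2.2.2 hX₁ he₁ hsurj₁ hr₁ hT S₀ hS₀ hS hS₁ hb)

/-- **`BSD(E,p)` from a rank partner in cell (M), `p ≥ 5`** (§1 Door 3 + the Kato upper half).
Per pair modulo `hK`, `hEPW`, `hT40`/`hT41` and the displayed certificates; books nothing by itself.
[cite: EmertonPollackWeston2006, Thm. 3.3.2, Thm. 3.3.3 (2) (arXiv:math/0404484 p. 19)]
[cite: Silverman1994, Thm. V.3.1, Thm. V.5.3, Cor. V.5.4] [cite: Kato2004Asterisque, Thm. 17.4 (3) (p. 273)]
[cite: Delbourgo1998, Prop. 4 (p. 144)] [cite: Miller2011LMS, Def. 1.1] -/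
theorem bsdp_rankZero_surj_of_epw_of_multPartner
    (hK : Wuthrich2014.kato_halfEigenCharIdeal_dvd_cyclotomicPrime_of_surjective)
    (hEPW : muLambdaAlg_transfer_of_torsionIso_potOrd)
    (hT40 : Silverman1994_thmV53_tateUniformisation.{0})
    (hT41 : Silverman1994_thmV53_corV54_tateUniformisation.{0})
    (hDel98 : Delbourgo1998.prop4_rankZero_pow_dvd_constantCoeff)
    (hDelG : Delbourgo1998.prop4_rankZero_constantCoeff_eq_unit_mul_of_potGoodOrd)
    (hPal : Pal2012.thm32_sqrt_mul_realPeriodRat_twist_eq_of_prime_one_mod_four)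
    (hGZK : rank_eq_analyticRank_of_analyticRank_le_one) (hmod : hasEntireLFunction_rat)
    (hmodD : nonempty_modularParametrizationData)
    (hc : N10.CellGordTwo W p) (hsurj : Surj W p) (hp5 : 5 ≤ p) (hr : W.analyticRank = 0)
    {W₁ : WeierstrassCurve ℚ} [W₁.IsElliptic] [W₁.IsGloballyMinimal]
    (hX₁ : ClassX4M W₁ p) (hsurj₁ : Surj W₁ p) {r₁ : ℕ} (hr₁ : r₁ ≤ W₁.mordellWeilRank)
    (hcong : ∃ e : geomTorsion W (p : ℤ) ≃+ geomTorsion W₁ (p : ℤ),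
      ∀ (σ : absoluteGaloisGroup ℚ) (P : geomTorsion W (p : ℤ)), e (σ • P) = σ • e P)
    (S₀ : Finset (HeightOneSpectrum (𝓞 ℚ))) (hS₀ : ∀ w ∈ S₀, ((p : ℕ) : 𝓞 ℚ) ∉ w.asIdeal)
    (hS : ∀ w : HeightOneSpectrum (𝓞 ℚ), w ∉ S₀ → ((p : ℕ) : 𝓞 ℚ) ∉ w.asIdeal →
      W.HasGoodReductionAt w)
    (hS₁ : ∀ w : HeightOneSpectrum (𝓞 ℚ), w ∉ S₀ → ((p : ℕ) : 𝓞 ℚ) ∉ w.asIdeal →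
      W₁.HasGoodReductionAt w)
    {b : ℕ} (hb : (b : ℤ) ≤ r₁ + ∑ w ∈ S₀, ((delta W₁ p w : ℤ) - (delta W p w : ℤ)))
    (hcert : BranchUnitCoeffAt W p b) : BSDp W p :=
  bsdp_rankZero_surj_of_katoHalf_of_coeffCert_of_budget hK hDel98 hDelG hPal hGZK hmod hmodD hc hsurj hp5 hr
    hcert
    ((classX4Gord_of_cellGordTwo_of_surj hc hsurj).budgetLeLambdaAt_of_epw_of_multPartner_of_congr hEPW
      hK hmodD hT40 hT41 hc.2.2.2 hX₁ hsurj₁ hr₁ hcong S₀ hS₀ hS hS₁ hb)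

/-! ## §3 The route's currency: `PrintedFacts` / `ReadingFacts`, and the crux BY NAME from row data -/

/-- **Door 1 with the route's fact conjunctions** (`PrintedFacts ⊇ {hGZK, hmod, hmodD}`,
`ReadingFacts ⊇ {hDelG}`): the lower half at a cell-(G-ord, `e = 2`) rank-0 pair with `ρ̄_{E,p}` onto
from Kato half, Pal and the certificate `(b, unit coefficient, budget)`.
[cite: Kato2004Asterisque, Thm. 17.4 (3) (p. 273)] [cite: Delbourgo1998, Prop. 4 (p. 144)] [cite: Miller2011LMS, Def. 1.1] -/
theorem missingLowerBoundAt_rankZero_surj_of_facts_of_coeffCert_of_budget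
    (hP : PrintedFacts) (hR : ReadingFacts)
    (hPal : Pal2012.thm32_sqrt_mul_realPeriodRat_twist_eq_of_prime_one_mod_four)
    (hK : Wuthrich2014.kato_halfEigenCharIdeal_dvd_cyclotomicPrime_of_surjective)
    (hc : N10.CellGordTwo W p) (hsurj : Surj W p) (hr : W.analyticRank = 0)
    {b : ℕ} (hcert : BranchUnitCoeffAt W p b) (hbud : BudgetLeLambdaAt p W b) :
    MissingLowerBoundAt W p := by
  obtain ⟨-, -, -, -, hGZK, hmod, hmodD, -⟩ := hP
  obtain ⟨-, -, -, -, hDelG⟩ := hR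
  exact missingLowerBoundAt_rankZero_surj_of_katoHalf_of_coeffCert_of_budget hK hDelG hPal hGZK hmod hmodD
    hc hsurj hr hcert hbud

/-- **`BSD(E,p)` (booking shape) with the route's fact conjunctions**, `p ≥ 5`
(`PrintedFacts ⊇ {hDel98, hGZK, hmod, hmodD}`, `ReadingFacts ⊇ {hDelG}`).
[cite: Kato2004Asterisque, Thm. 17.4 (3) (p. 273)] [cite: Delbourgo1998, Prop. 4 (p. 144)] [cite: Miller2011LMS, Def. 1.1] -/
theorem bsdp_rankZero_surj_of_facts_of_coeffCert_of_budget
    (hP : PrintedFacts) (hR : ReadingFacts)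
    (hPal : Pal2012.thm32_sqrt_mul_realPeriodRat_twist_eq_of_prime_one_mod_four)
    (hK : Wuthrich2014.kato_halfEigenCharIdeal_dvd_cyclotomicPrime_of_surjective)
    (hc : N10.CellGordTwo W p) (hsurj : Surj W p) (hp5 : 5 ≤ p) (hr : W.analyticRank = 0)
    {b : ℕ} (hcert : BranchUnitCoeffAt W p b) (hbud : BudgetLeLambdaAt p W b) : BSDp W p := by
  obtain ⟨-, -, -, hDel98, hGZK, hmod, hmodD, -⟩ := hP
  obtain ⟨-, -, -, -, hDelG⟩ := hR
  exact bsdp_rankZero_surj_of_katoHalf_of_coeffCert_of_budget hK hDel98 hDelG hPal hGZK hmod hmodD hc hsurj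
    hp5 hr hcert hbud

/-- **Crux 19357 BY NAME from row data (what a per-pair certificate buys, and no more).** From the
route's facts, the CM BSD formula (`hCM`, Burungale–Flach / Rubin), Pal and Kato half: IF every NON-CM
CONTENT off-Case-1 rank-0 pair of cell (G-ord, `e = 2`) (i.e. `#Ш(E)_an` of positive `p`-adic valuation
whenever rational) EITHER has `ρ̄_{E,p}` onto together with an index `b`, a unit coefficient at `b` and
the budget `b ≤ λ` (Door 1; supplied on Tamagawa rows by EPW Cor. 3.2.5 and on pure-Ш rows by a
rank-`≥ λ` partner, Doors 2–3), OR satisfies the `T = 0` lower input `CycLowerLeadingTermAt W p`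
outright, THEN `GordTwoRankZeroOffCaseOne`. The hypothesis is NOT a theorem (non-surjective
irreducible rows, the Eisenstein-degenerate reducible rows and the pure-Ш rows without a partner in
range have no door): the crux stays OPEN; this records the exact reach of the certificates.
[cite: Kato2004Asterisque, Thm. 17.4 (3) (p. 273)] [cite: BurungaleFlach2024, Thm. 1.1 and Cor. 2]
[cite: Delbourgo1998, Prop. 4 (p. 144) and Main Conjecture (p. 151)] [cite: Miller2011LMS, Def. 1.1] -/
theorem gordTwoRankZeroOffCaseOne_of_facts_of_routeG
    (hP : PrintedFacts) (hR : ReadingFacts) (hCM : bsdTriple_of_hasCM_of_L_one_ne_zero)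
    (hPal : Pal2012.thm32_sqrt_mul_realPeriodRat_twist_eq_of_prime_one_mod_four)
    (hK : Wuthrich2014.kato_halfEigenCharIdeal_dvd_cyclotomicPrime_of_surjective)
    (hRows : ∀ (W : WeierstrassCurve ℚ) [W.IsElliptic] [W.IsGloballyMinimal] (p : ℕ) [Fact p.Prime],
      W.analyticRank = 0 → N10.CellGordTwo W p → ¬ HasCaseOneMember W p → ¬ W.HasCM →
      (∀ q : ℚ, shaAn W = (q : ℂ) → 0 < padicValRat p q) →
        (Surj W p ∧ ∃ b : ℕ, BranchUnitCoeffAt W p b ∧ BudgetLeLambdaAt p W b) ∨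
          CycLowerLeadingTermAt W p) :
    GordTwoRankZeroOffCaseOne := by
  obtain ⟨-, -, -, -, hGZK, hmod, hmodD, -⟩ := hP
  obtain ⟨-, -, -, -, hDelG⟩ := hR
  intro W _ _ p _ hr hc hno
  by_cases hcm : W.HasCM
  · exact missingLowerBoundAt_rankZero_of_hasCM_of_burungaleFlach hCM hmod hGZK hcm hr
  by_cases hq : ∃ q : ℚ, shaAn W = (q : ℂ) ∧ padicValRat p q ≤ 0
  · obtain ⟨q, hq, hv⟩ := hq
    exact N10.missingLowerBoundAt_of_padicValRat_le_zero W p hq hv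
  · push Not at hq
    rcases hRows W p hr hc hno hcm hq with ⟨hsurj, b, hcert, hbud⟩ | hLow
    · exact missingLowerBoundAt_rankZero_surj_of_katoHalf_of_coeffCert_of_budget hK hDelG hPal hGZK hmod
        hmodD hc hsurj hr hcert hbud
    · exact missingLowerBoundAt_cellGordTwo_rankZero_of_cycLowerLeadingTerm hDelG hGZK hmod hc hr hLow

end Summit.BirchSwinnertonDyer.BirchSwinnertonDyer.Theorems.AdditiveBranchIMCGordTwoRankZeroIrreducible

end
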